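import Literature.MathematicalPhysics.QuantumFieldTheory.Balaban1983to89.B3Op116CollarRows
import Literature.MathematicalPhysics.QuantumFieldTheory.Balaban1983to89.B3Op116CollarSources
import Literature.MathematicalPhysics.QuantumFieldTheory.Balaban1983to89.B3Op116HolderKernelRegularTorus

/-!
# Bałaban, *(Higgs)₂,₃ quantum fields in a finite volume III. Renormalization* [B3] — the kernel of the operator (1.16) p. 414 at
FAR-SEPARATED arguments, file «CollarHolder» of the cell's Route δ (class (c) of p. 433): THE TWO-ANCHOR (HÖLDER-TRANSPORTED) ROW of
the one-`V_k` collar operator `G_k(Ω,X)V_k^Ω(P,Y)G_k(Ω,X′)` through the LONG-LEG ENGINE — the Leibniz form of the sources (no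
twice-differentiated kernel) plus the FACE CHARGES of the bonds of `supp P` crossing `∂Ω`, summed over `(d−1)`-dimensional slices

statement-level skeleton of published theorems with citation tags; proofs where landed; nothing here is a claim about the Yang–Mills mass gap

T. Bałaban, Commun. Math. Phys. **88** (1983) 411–445 [cite: Balaban1983Higgs3]; part I, Commun. Math. Phys. **85** (1982) 603–636
[cite: Balaban1982Higgs1].  PDFs held: `paper:balaban1983-higgs-2-3-quantum-fields-finite-volume` (journal page = PDF page + 410;
p. 414 = `p0004.txt`, p. 426 = `p0016.txt`, p. 433 = `p0023.txt`), `paper:balaban1982-cmp85-higgs23-i` (p. 615 = `p0013.txt`).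

CITATION HEADER (lean-in-tree rule).  Cell `lit-balaban` (HOME `run/shared/lean/pub/lit-balaban/`), Phase-2 proof seat **p40** gen 77
(unit `lit-balaban-p40`, literature-prover-lit-balaban-p40-g77-0); free-target protocol G.5-34(d), TAKING line HOME/STATUS.md
2026-08-23T12:41:06Z (cc r15 = fold owner of rows B3.Txt@433 / B3.Prop1 / B3.Eq1.16 / B3.Eq2.5 / B3.Eq2.11, p35, r14, p33); design note
`lit-balaban-p40/DESIGN-B3-116-box.md` v3 §1c/§5/§5.1 (Route δ, recorded by the owner as the cell's candidate proof-route deviation for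
class (c), HOME/GAPS.md «G-B3-16 ADDENDUM 1», owner note l.2887).  LOCATED SUPPORT FILE — no head claim.  USED BY NAME, never restated:
p40 g77's `B3Op116CollarRows.{Far, top, farF, farC, faceC, collarC, collar_row_two_le, sum_face_far_pair_le}` (the engine, v1.1) and
`B3Op116CollarSources.{inB, exB, enB, NearSupp, norm_mapE_srcV_collar_leibniz_le, norm_mapE_avgSrc_near_le, propagatorK_single_apply_eq_zero_of_not_mem,
propagatorK_cb_apply_eq_zero_of_mem, covDeriv_eq_zero_of_apply_eq_zero}` (v1.1), p35's `B3Op116MajorantStep.{maj, mul_maj}`,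
`B3Op116LeibnizRows.pred`, `B3Op116HolderKernelRegularTorus.holT`, r14's `B3Op116SourceForm.{srcV, avgSrc, op116_succ_left_apply,
op116_succ_right_apply, op116_zero_zero_apply}`, the typer's `HiggsLattice`/`HiggsCovariance`/`HiggsAveraging`, `B1TorusChainTransport.hol`.

## What is printed

[B3] p. 414 [PDF 4] (verbatim): *"the Hölder norms of the covariant derivatives of this kernel, the norms defined for example in the
inequalities (I.2.24) and (I.2.25) of Proposition I.2.1, are exponentially decaying with the distance of the arguments and are uniformly
bounded by O(1)(e(L^kε)^{1−α})^{n+n′}, where α > 0 but can be arbitrarily small."*  p. 426 (2.11) [PDF 16]: the Hölder member of the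
propagator estimates, *"if the propagator is differentiated, then for each differentiation, there is an additional factor (L^jη)^{−1} on
the right side. This applies also to Hölder norms"*.  p. 433 [PDF 23] (class (c)): *"We have B̃ = B̃₀ + B̃′, and we expand in B̃′ …
we include the operators (1.16) … into the external fields"* — the cell's recorded route reads the collar part `P` of the perturbation,
supported far (`≥ R = ρL^k` lattice units) from the localization points and anywhere in `□` up to its faces.

## What this file proves, and how

§1 two bookkeeping lemmas: a sum over a set covered by a finite family of pieces is below the sum over the pieces (`sum_le_sum_cover`), and
a sum over bonds of a function of the initial (resp. final) point is below `d` times the sum over the image (`sum_src_le`, `sum_tgt_le`: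
at most `d` bonds share an endpoint of a given kind).
§2 **`holder_row_collar_le`** — THE TWO-ANCHOR ROW OF THE ONE-`V_k` COLLAR OPERATOR.  Region `Ω`, perturbation `A = P` (`sup|P| ≤ s`,
(I.2.23)-regular with `δ_P`), derivative background `Y`; a vector-valued linear functional `T` KILLING every single-site field off `Ω` whose
columns obey a TWO-ANCHOR majorant `Σ_i‖Te_{(y,i)}‖ ≤ 𝔪_k(c_K,a_K;δ)(p₁,y) + 𝔪_k(c_K,a_K;δ)(p₂,y)` (the Hölder-transported differentiated row
of `G_k(Ω,X)`, `a_K = 1 − α`, the factor `(ε|p₁−p₂|)^α` folded into `c_K` by `mul_maj`); a finite family of states `w_{i′}` vanishing off `Ω`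
with `Σ_{i′}‖w_{i′}(u)‖ ≤ 𝔪_k(c_v,a_v;δ)(u,x′)` and `Σ_{i′}‖(D^ε_Yw_{i′})(b)‖ ≤ 𝔪_k(c_d,a_v−1;δ)(b₋,x′)` at the charged bonds inside `Ω`; a
finite family `Fc` of lattice slices `{s : s_ν = c}` covering the initial points of the charged bonds leaving `Ω` and the final points of
the bonds of `supp P` entering `Ω` (the faces of a box: `2d` slices); and the FAR GEOMETRY (every endpoint of a charged bond and every site of a
`k`-block met by `supp P` is far from `p₁`, `p₂`, and the endpoints are far from `x′`).  THEN
`Σ_{i′}‖T(V_k^Ω(P,Y)w_{i′})‖ ≤ [top_k(farF·collarC(…), a_K+a_v−1; δ/4)(p₁,x′) + (p₂)] + |Fc|·d·(κ_ex + κ_en)·[top_k(farF·c_K·farC·c_v·faceC(δ/2), a_K+a_v−1; δ/4)(p₁,x′) + (p₂)]`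
with `κ_ex = ε^{−1}|e|δ_P + ε^{−1}|e|s`, `κ_en = 3ε^{−1}|e|s + 2(|e|s)²` — p40's located Leibniz row (`norm_mapE_srcV_collar_leibniz_le`) summed
over the family, the bulk through `collar_row_two_le` (`κ₁ = |e|s`, `κ₂ = ε^{−1}|e|δ_P`, `κ₃ = (|e|s)²`, no face slot, averaging slot
`κ₄ = |a_k|(L^kε)^{−2}m(2+m)`), the faces through `sum_face_far_pair_le` slice by slice (exponent `a_K + a_v − 1`, normalization `ε^{−d}`).
§3 the two instances for the operator (1.16): `holder_row_op116_one_zero_le` (`T = holT_{x₁,x₂,Γ,μ} ∘ G_k(Ω,Y)`, states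
`G_k(Ω,P+Y)e_{(x′,i′)}`) and `holder_row_op116_zero_one_le` (`T = holT ∘ G_k(Ω,P+Y)`, states `G_k(Ω,Y)e_{(x′,i′)}`) on a `k`-block union `Ω`
(`m² > 0`, `a_k ≥ 0`), the bonds `⟨x₁,x₁+εe_μ⟩, ⟨x₂,x₂+εe_μ⟩ ⊂ Ω`, `x′ ∈ Ω` — the `hH`/`hH′` rows of the (1.32)-norm assembly
`B3Ineq25Op116SmoothInner.ineq25At_op116_smooth_of_bounds_inner` up to the dictionary (the plug file).

## Honest scope

Row algebra + the engine only: the two-anchor (2.11) dictionary entry of `G_k(Ω,X)` (p35 g21's `B3Op116BoxRows.hcolB_le` on a cell-product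
box), the (2.10) columns of `G_k(Ω,X′)`, the `Y`- versus `(P+Y)`-transport/derivative conversions near `x₁, x₂` and the face family of a box
are HYPOTHESES here (the plug file); constants explicit, not yet in print's running currency `e(L^kε)p(L^kε)`; the near/far split in
`|x₁ − x₂|` of the Hölder quotient is the plug's.  The class-(c) use on `□` is a RECORDED ROUTE DEVIATION from p. 433 l.12–15 (print's one-piece
expansion on `□` is the cell's located open gap G-B3-16.A1); nothing of (1.16)/(2.5) is asserted beyond the displayed rows.  Theorems only:
no `def`, no `def … : Prop`, no new named fact, no `sorry`; axioms standard.  Value = located engine of a by-reference step of B3 — NOT summit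
progress and nothing about the Yang–Mills mass gap.
-/

noncomputable section

open scoped BigOperators

namespace Literature.MathematicalPhysics.QuantumFieldTheory.Balaban1983to89.B3Op116CollarHolder

open HiggsLattice (ChargeData ScalarField covDeriv)
open HiggsCovariance (propagatorK E)
open HiggsCovariancePos (unshift_shift)
open HiggsAveraging (blockK blockIter)
open B1Eq230FluctCov (Ix cb)
open B1TorusChainTransport (hol)
open B3Ineq210MixedRegularTorus (cb_eq_single)
open B3Eq116TwoSidedExpansion (op116)
open B3Op116SourceForm (srcV avgSrc op116_succ_left_apply op116_succ_right_apply op116_zero_zero_apply)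
open B3Op116MajorantStep (maj maj_nonneg)
open B3Op116LeibnizRows (pred)
open B3Op116CollarRows (Far top farF farC faceC collarC collar_row_two_le sum_face_far_pair_le top_nonneg farF_pos farC_pos faceC_nonneg)
open B3Op116CollarSources (NearSupp inB exB enB mem_inB mem_exB mem_enB norm_mapE_srcV_collar_leibniz_le norm_mapE_avgSrc_near_le
  avgM_nonneg propagatorK_single_apply_eq_zero_of_not_mem propagatorK_cb_apply_eq_zero_of_mem covDeriv_eq_zero_of_apply_eq_zero)
open B3Op116HolderKernelRegularTorus (holT holT_apply)

variable {P : HiggsLattice.Params} {N : ℕ}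

/-! ## §1 Two bookkeeping lemmas: covered sums, and bond sums read at an endpoint -/

section Book

/-- A sum of nonnegative terms over a set covered by finitely many pieces is below the sum of the sums over the pieces.
[cite: Balaban1983Higgs3, (2.13) p.426] -/
theorem sum_le_sum_cover {ι κ : Type*} (S : Finset ι) (Fc : Finset κ) (R : κ → ι → Prop) [∀ f i, Decidable (R f i)]
    (g : ι → ℝ) (hg : ∀ i ∈ S, 0 ≤ g i) (hcov : ∀ i ∈ S, ∃ f ∈ Fc, R f i) :
    ∑ i ∈ S, g i ≤ ∑ f ∈ Fc, ∑ i ∈ S.filter (R f), g i := by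
  have h : ∀ i ∈ S, g i ≤ ∑ f ∈ Fc, (if R f i then g i else 0) := by
    intro i hi
    obtain ⟨f, hf, hR⟩ := hcov i hi
    have h1 := Finset.single_le_sum (s := Fc) (f := fun f' => if R f' i then g i else 0)
      (fun f' _ => by split_ifs; exacts [hg i hi, le_rfl]) hf
    simpa only [if_pos hR] using h1
  calc ∑ i ∈ S, g i ≤ ∑ i ∈ S, ∑ f ∈ Fc, (if R f i then g i else 0) := Finset.sum_le_sum h
    _ = ∑ f ∈ Fc, ∑ i ∈ S, (if R f i then g i else 0) := Finset.sum_comm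
    _ = ∑ f ∈ Fc, ∑ i ∈ S.filter (R f), g i := Finset.sum_congr rfl fun f _ => (Finset.sum_filter _ _).symm

/-- At most `d` positive bonds start at a given site: a bond sum of a nonnegative function of the initial point is below `d` times the site
sum over the initial points. [cite: Balaban1982Higgs1, (1.4) p.604] -/
theorem sum_src_le (B : Finset (HiggsLattice.PBond P 0)) (h : HiggsLattice.Site P 0 → ℝ) (hh : ∀ y, 0 ≤ h y) :
    ∑ b ∈ B, h b.src ≤ (P.d : ℝ) * ∑ y ∈ B.image (fun b => b.src), h y := by
  classical
  rw [Finset.sum_comp, Finset.mul_sum]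
  refine Finset.sum_le_sum fun y _ => ?_
  rw [nsmul_eq_mul]
  refine mul_le_mul_of_nonneg_right ?_ (hh y)
  have hc : (B.filter (fun b => b.src = y)).card ≤ (Finset.univ : Finset (Fin P.d)).card := by
    refine Finset.card_le_card_of_injOn (fun b => b.dir) (fun b _ => Finset.mem_coe.2 (Finset.mem_univ _)) ?_
    intro b₁ hb₁ b₂ hb₂ hdir
    have h1 := (Finset.mem_filter.1 (Finset.mem_coe.1 hb₁)).2
    have h2 := (Finset.mem_filter.1 (Finset.mem_coe.1 hb₂)).2
    cases b₁; cases b₂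
    simp only at h1 h2 hdir
    subst h1; subst h2; subst hdir; rfl
  rw [Finset.card_univ, Fintype.card_fin] at hc
  exact_mod_cast hc

/-- At most `d` positive bonds end at a given site: the same for the final point. [cite: Balaban1982Higgs1, (1.4) p.604] -/
theorem sum_tgt_le (B : Finset (HiggsLattice.PBond P 0)) (h : HiggsLattice.Site P 0 → ℝ) (hh : ∀ y, 0 ≤ h y) :
    ∑ b ∈ B, h b.tgt ≤ (P.d : ℝ) * ∑ y ∈ B.image (fun b => b.tgt), h y := by
  classical
  rw [Finset.sum_comp, Finset.mul_sum]
  refine Finset.sum_le_sum fun y _ => ?_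
  rw [nsmul_eq_mul]
  refine mul_le_mul_of_nonneg_right ?_ (hh y)
  have hc : (B.filter (fun b => b.tgt = y)).card ≤ (Finset.univ : Finset (Fin P.d)).card := by
    refine Finset.card_le_card_of_injOn (fun b => b.dir) (fun b _ => Finset.mem_coe.2 (Finset.mem_univ _)) ?_
    intro b₁ hb₁ b₂ hb₂ hdir
    have h1 := (Finset.mem_filter.1 (Finset.mem_coe.1 hb₁)).2
    have h2 := (Finset.mem_filter.1 (Finset.mem_coe.1 hb₂)).2
    have hs₁ : b₁.src = y.unshift b₁.dir := by rw [← h1, HiggsLattice.PBond.tgt, unshift_shift]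
    have hs₂ : b₂.src = y.unshift b₂.dir := by rw [← h2, HiggsLattice.PBond.tgt, unshift_shift]
    cases b₁; cases b₂
    simp only at hdir hs₁ hs₂
    subst hdir
    rw [hs₁, hs₂]
  rw [Finset.card_univ, Fintype.card_fin] at hc
  exact_mod_cast hc

end Book

/-! ## §2 The two-anchor row of the one-`V_k` collar operator -/

section HolderRow

open scoped Classical

variable (C : ChargeData N) (Ω : Finset (HiggsLattice.Site P 0)) (A Y : HiggsLattice.VecField P 0) (a : ℝ) {k : ℕ}
variable {M' : Type*} [NormedAddCommGroup M'] [NormedSpace ℝ M']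

/-- **THE TWO-ANCHOR ROW OF THE ONE-`V_k` COLLAR OPERATOR** (see the module docstring, §2): bulk Leibniz charges through
`collar_row_two_le`, face charges through `sum_face_far_pair_le`, averaging sources over the near blocks.
[cite: Balaban1983Higgs3, (1.16) p.414, (2.11) p.426, p.433] [cite: Balaban1982Higgs1, (3.16) p.615] -/
theorem holder_row_collar_le (hL2 : 2 ≤ P.L) (hkK : k ≤ P.K) {δ ρ : ℝ} (hδ : 0 < δ) (hδ1 : δ ≤ 1) (hρ : 1 ≤ ρ)
    {s δA cK cv cd aK av : ℝ} (hs : 0 ≤ s) (hδA : 0 ≤ δA) (hcK : 0 ≤ cK) (hcv : 0 ≤ cv) (hcd : 0 ≤ cd) (haK : 0 ≤ aK) (hav : 1 ≤ av)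
    (hA : ∀ b : HiggsLattice.PBond P 0, |A b| ≤ s)
    (hregA : ∀ (z : HiggsLattice.Site P 0) (μ ν : Fin P.d), |A ⟨z.shift ν, μ⟩ - A ⟨z, μ⟩| ≤ δA) (i₀ : Ix N)
    (T : ScalarField P 0 N →ₗ[ℝ] M') (hT : ∀ y : HiggsLattice.Site P 0, y ∉ Ω → ∀ v : E N, T (Pi.single y v) = 0)
    (p₁ p₂ x' : HiggsLattice.Site P 0) (w : Ix N → ScalarField P 0 N) (hw : ∀ (i' : Ix N) (y : HiggsLattice.Site P 0), y ∉ Ω → w i' y = 0)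
    (hK : ∀ y, ∑ i : Ix N, ‖T (cb P N 0 (y, i))‖ ≤ maj P k cK aK δ p₁ y + maj P k cK aK δ p₂ y)
    (hV : ∀ u, ∑ i' : Ix N, ‖w i' u‖ ≤ maj P k cv av δ u x')
    (hD : ∀ b ∈ inB Ω A, ∑ i' : Ix N, ‖covDeriv C Y (w i') b‖ ≤ maj P k cd (av - 1) δ b.src x')
    (Fc : Finset (Σ ν : Fin P.d, ZMod (P.sitesPerDir 0 ν)))
    (hexF : ∀ b ∈ exB Ω A, ∃ f ∈ Fc, b.src f.1 = f.2) (henF : ∀ b ∈ enB Ω A, ∃ f ∈ Fc, b.tgt f.1 = f.2)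
    (hfar : ∀ b : HiggsLattice.PBond P 0, (A b ≠ 0 ∨ A (pred b) ≠ 0) →
      Far P k ρ p₁ b.src ∧ Far P k ρ p₂ b.src ∧ Far P k ρ b.src x')
    (hfarT : ∀ b : HiggsLattice.PBond P 0, A b ≠ 0 → Far P k ρ p₁ b.tgt ∧ Far P k ρ p₂ b.tgt ∧ Far P k ρ b.tgt x')
    (hfarZ : ∀ b : HiggsLattice.PBond P 0, A b ≠ 0 → ∀ z : HiggsLattice.Site P 0, blockIter k z = blockIter k b.src →
      Far P k ρ p₁ z ∧ Far P k ρ p₂ z) :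
    ∑ i' : Ix N, ‖T (srcV C A Y k Ω a (w i'))‖
      ≤ (top P k (farF P δ ρ * collarC P N k δ aK 0 av cK 0 cv cd (|C.e| * s) ((P.mesh 0)⁻¹ * (|C.e| * δA)) ((|C.e| * s) ^ 2) 0 0
              (|B1.aSeq a P.L k| * (P.mesh k)⁻¹ ^ 2 *
                ((|C.e| * s * P.mesh 0 * (P.d * ((P.L : ℝ) ^ k - 1))) * (2 + |C.e| * s * P.mesh 0 * (P.d * ((P.L : ℝ) ^ k - 1))))))
            (aK + av - 1) (δ / 4) p₁ x'
          + top P k (farF P δ ρ * collarC P N k δ aK 0 av cK 0 cv cd (|C.e| * s) ((P.mesh 0)⁻¹ * (|C.e| * δA)) ((|C.e| * s) ^ 2) 0 0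
              (|B1.aSeq a P.L k| * (P.mesh k)⁻¹ ^ 2 *
                ((|C.e| * s * P.mesh 0 * (P.d * ((P.L : ℝ) ^ k - 1))) * (2 + |C.e| * s * P.mesh 0 * (P.d * ((P.L : ℝ) ^ k - 1))))))
            (aK + av - 1) (δ / 4) p₂ x')
        + (Fc.card : ℝ) * P.d *
            (((P.mesh 0)⁻¹ * (|C.e| * δA) + (P.mesh 0)⁻¹ * (|C.e| * s)) + (3 * ((P.mesh 0)⁻¹ * (|C.e| * s)) + 2 * (|C.e| * s) ^ 2)) *
          (top P k (farF P δ ρ * cK * (farC P δ * cv) * faceC P (δ / 2)) (aK + av - 1) (δ / 4) p₁ x'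
            + top P k (farF P δ ρ * cK * (farC P δ * cv) * faceC P (δ / 2)) (aK + av - 1) (δ / 4) p₂ x') := by
  -- abbreviations
  set K : HiggsLattice.Site P 0 → ℝ := fun y => ∑ i : Ix N, ‖T (cb P N 0 (y, i))‖ with hKdef
  set V : HiggsLattice.Site P 0 → ℝ := fun u => ∑ i' : Ix N, ‖w i' u‖ with hVdef
  set D : HiggsLattice.PBond P 0 → ℝ := fun b => ∑ i' : Ix N, ‖covDeriv C Y (w i') b‖ with hDdef
  set M₁ : HiggsLattice.Site P 0 → ℝ := fun y => maj P k cK aK δ p₁ y with hM₁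
  set M₂ : HiggsLattice.Site P 0 → ℝ := fun y => maj P k cK aK δ p₂ y with hM₂
  set m : ℝ := |C.e| * s * P.mesh 0 * (P.d * ((P.L : ℝ) ^ k - 1)) with hm
  set κ₄ : ℝ := |B1.aSeq a P.L k| * (P.mesh k)⁻¹ ^ 2 * (m * (2 + m)) with hκ₄
  set κ₂ : ℝ := (P.mesh 0)⁻¹ * (|C.e| * δA) with hκ₂
  set κex : ℝ := (P.mesh 0)⁻¹ * (|C.e| * δA) + (P.mesh 0)⁻¹ * (|C.e| * s) with hκex
  set κen : ℝ := 3 * ((P.mesh 0)⁻¹ * (|C.e| * s)) + 2 * (|C.e| * s) ^ 2 with hκen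
  set Sz : Finset (HiggsLattice.Site P 0) := Finset.univ.filter (fun y : HiggsLattice.Site P 0 => NearSupp k A y) with hSz
  set tf : HiggsLattice.Site P 0 → ℝ := fun p =>
    top P k (farF P δ ρ * cK * (farC P δ * cv) * faceC P (δ / 2)) (aK + av - 1) (δ / 4) p x' with htf
  have hε0 : 0 ≤ (P.mesh 0)⁻¹ := inv_nonneg.mpr (P.mesh_pos 0).le
  have hes : 0 ≤ |C.e| * s := mul_nonneg (abs_nonneg _) hs
  have hm0 : 0 ≤ m := avgM_nonneg C k hs
  have hκ₄0 : 0 ≤ κ₄ := by rw [hκ₄]; positivity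
  have hκ₂0 : 0 ≤ κ₂ := mul_nonneg hε0 (mul_nonneg (abs_nonneg _) hδA)
  have hκex0 : 0 ≤ κex := add_nonneg hκ₂0 (mul_nonneg hε0 hes)
  have hκen0 : 0 ≤ κen := by rw [hκen]; positivity
  have hd0 : (0 : ℝ) ≤ (P.d : ℝ) := Nat.cast_nonneg _
  have hK0 : ∀ y, 0 ≤ K y := fun y => Finset.sum_nonneg fun _ _ => norm_nonneg _
  have hV0 : ∀ u, 0 ≤ V u := fun u => Finset.sum_nonneg fun _ _ => norm_nonneg _
  have hD0 : ∀ b, 0 ≤ D b := fun b => Finset.sum_nonneg fun _ _ => norm_nonneg _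
  have hM₁0 : ∀ y, 0 ≤ M₁ y := fun y => maj_nonneg hcK p₁ y
  have hM₂0 : ∀ y, 0 ≤ M₂ y := fun y => maj_nonneg hcK p₂ y
  have hKM : ∀ y, K y ≤ M₁ y + M₂ y := hK
  have htf0 : ∀ p, 0 ≤ tf p := fun p => top_nonneg
    (mul_nonneg (mul_nonneg (mul_nonneg (farF_pos hδ ρ).le hcK) (mul_nonneg (farC_pos (P := P) hδ).le hcv))
      (faceC_nonneg (by positivity))) p x'
  -- step 1: the located Leibniz row, per state, with the averaging sources over the near blocks
  have hrow : ∀ i' : Ix N, ‖T (srcV C A Y k Ω a (w i'))‖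
      ≤ (∑ b ∈ inB Ω A, (|C.e| * s * ‖covDeriv C Y (w i') b‖ * K b.tgt
            + (κ₂ * ‖w i' b.src‖ + |C.e| * s * ‖covDeriv C Y (w i') b‖) * K b.src + (|C.e| * s) ^ 2 * ‖w i' b.tgt‖ * K b.tgt))
        + (∑ b ∈ exB Ω A, κex * ‖w i' b.src‖ * K b.src) + (∑ b ∈ enB Ω A, κen * ‖w i' b.tgt‖ * K b.tgt)
        + κ₄ * ∑ z ∈ Sz, K z * (((P.L : ℝ) ^ (k * P.d))⁻¹ * ∑ u ∈ blockK k (blockIter k z), ‖w i' u‖) := by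
    intro i'
    have h1 := norm_mapE_srcV_collar_leibniz_le C Y (Ω := Ω) (A := A) a k T hs hδA hA hregA hT (w i') (hw i')
    have h2 := norm_mapE_avgSrc_near_le C A Y (k := k) T hkK hs hA (w i')
    refine h1.trans (add_le_add (le_of_eq ?_) ?_)
    · simp only [hKdef, hκ₂, hκex, hκen]
    · rw [hκ₄, hSz]
      have hc : 0 ≤ |B1.aSeq a P.L k| * (P.mesh k)⁻¹ ^ 2 := by positivity
      calc |B1.aSeq a P.L k| * (P.mesh k)⁻¹ ^ 2 * ‖T (avgSrc C A Y k (w i'))‖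
          ≤ |B1.aSeq a P.L k| * (P.mesh k)⁻¹ ^ 2 *
              ∑ y ∈ Finset.univ.filter (fun y : HiggsLattice.Site P 0 => NearSupp k A y),
                (m * (2 + m) * (((P.L : ℝ) ^ (k * P.d))⁻¹ * ∑ u ∈ blockK k (blockIter k y), ‖w i' u‖)) * K y :=
            mul_le_mul_of_nonneg_left h2 hc
        _ = _ := by
            rw [mul_assoc (|B1.aSeq a P.L k| * (P.mesh k)⁻¹ ^ 2) (m * (2 + m)), Finset.mul_sum, Finset.mul_sum, Finset.mul_sum]
            exact Finset.sum_congr rfl fun y _ => by ring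
  -- step 2: sum over the family and exchange the sums
  have hsum : ∑ i' : Ix N, ‖T (srcV C A Y k Ω a (w i'))‖
      ≤ (∑ b ∈ inB Ω A, (|C.e| * s * D b * K b.tgt + (κ₂ * V b.src + |C.e| * s * D b) * K b.src + (|C.e| * s) ^ 2 * V b.tgt * K b.tgt))
        + (κex * ∑ b ∈ exB Ω A, V b.src * K b.src) + (κen * ∑ b ∈ enB Ω A, V b.tgt * K b.tgt)
        + κ₄ * ∑ z ∈ Sz, K z * (((P.L : ℝ) ^ (k * P.d))⁻¹ * ∑ u ∈ blockK k (blockIter k z), V u) := by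
    refine (Finset.sum_le_sum fun i' _ => hrow i').trans (le_of_eq ?_)
    rw [Finset.sum_add_distrib, Finset.sum_add_distrib, Finset.sum_add_distrib]
    have hb : ∑ i' : Ix N, ∑ b ∈ inB Ω A, (|C.e| * s * ‖covDeriv C Y (w i') b‖ * K b.tgt
            + (κ₂ * ‖w i' b.src‖ + |C.e| * s * ‖covDeriv C Y (w i') b‖) * K b.src + (|C.e| * s) ^ 2 * ‖w i' b.tgt‖ * K b.tgt)
        = ∑ b ∈ inB Ω A, (|C.e| * s * D b * K b.tgt + (κ₂ * V b.src + |C.e| * s * D b) * K b.src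
            + (|C.e| * s) ^ 2 * V b.tgt * K b.tgt) := by
      rw [Finset.sum_comm]
      refine Finset.sum_congr rfl fun b _ => ?_
      simp only [hDdef, hVdef, Finset.sum_add_distrib, ← Finset.sum_mul, ← Finset.mul_sum]
    have hx : ∑ i' : Ix N, ∑ b ∈ exB Ω A, κex * ‖w i' b.src‖ * K b.src = κex * ∑ b ∈ exB Ω A, V b.src * K b.src := by
      rw [Finset.sum_comm, Finset.mul_sum]
      refine Finset.sum_congr rfl fun b _ => ?_
      simp only [hVdef, ← Finset.sum_mul, ← Finset.mul_sum]
      ring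
    have hn : ∑ i' : Ix N, ∑ b ∈ enB Ω A, κen * ‖w i' b.tgt‖ * K b.tgt = κen * ∑ b ∈ enB Ω A, V b.tgt * K b.tgt := by
      rw [Finset.sum_comm, Finset.mul_sum]
      refine Finset.sum_congr rfl fun b _ => ?_
      simp only [hVdef, ← Finset.sum_mul, ← Finset.mul_sum]
      ring
    have hz : ∑ i' : Ix N, κ₄ * ∑ z ∈ Sz, K z * (((P.L : ℝ) ^ (k * P.d))⁻¹ * ∑ u ∈ blockK k (blockIter k z), ‖w i' u‖)
        = κ₄ * ∑ z ∈ Sz, K z * (((P.L : ℝ) ^ (k * P.d))⁻¹ * ∑ u ∈ blockK k (blockIter k z), V u) := by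
      rw [← Finset.mul_sum]
      congr 1
      rw [Finset.sum_comm]
      refine Finset.sum_congr rfl fun z _ => ?_
      simp only [hVdef]
      rw [← Finset.mul_sum, Finset.sum_comm, ← Finset.mul_sum]
    rw [hb, hx, hn, hz]
  -- step 3: the bulk (charged bonds inside `Ω`) and the averaging sources — `collar_row_two_le` with no face slot
  have hSfar : ∀ b ∈ inB Ω A, Far P k ρ p₁ b.src ∧ Far P k ρ p₂ b.src ∧ Far P k ρ b.src x' := fun b hb =>
    hfar b (mem_inB.1 hb).2
  have hSzfar : ∀ z ∈ Sz, Far P k ρ p₁ z ∧ Far P k ρ p₂ z := by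
    intro z hz
    rw [hSz, Finset.mem_filter] at hz
    obtain ⟨b, hb, hbz⟩ := hz.2
    exact hfarZ b hb z hbz.symm
  have hbulk := collar_row_two_le (N := N) hL2 hkK hδ hδ1 hρ (aK := aK) (av := av) haK hav hcK hcv hcd hes hκ₂0 (pow_nonneg hes 2)
    le_rfl hκ₄0 i₀ p₁ p₂ x' (inB Ω A) ∅ Sz K hKM V hV0 hV D hD0 hD hSfar (fun y hy => absurd hy (Finset.notMem_empty y)) hSzfar
  rw [Finset.sum_empty, mul_zero, add_zero] at hbulk
  -- step 4: a face sum over one slice, two anchors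
  have hface : ∀ (F : Finset (HiggsLattice.Site P 0)) (f : Σ ν : Fin P.d, ZMod (P.sitesPerDir 0 ν)),
      (∀ s' ∈ F, s' f.1 = f.2) → (∀ s' ∈ F, Far P k ρ p₁ s' ∧ Far P k ρ p₂ s' ∧ Far P k ρ s' x') →
      ∑ y ∈ F, V y * K y ≤ tf p₁ + tf p₂ := by
    intro F f hF hFfar
    have h₁ := sum_face_far_pair_le hL2 hδ hδ1 hρ haK (zero_le_one.trans hav) hcK hcv hF p₁ x' M₁ V hM₁0 hV0
      (fun s' _ => le_rfl) (fun s' _ => hV s') (fun s' hs' => ⟨(hFfar s' hs').1, (hFfar s' hs').2.2⟩)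
    have h₂ := sum_face_far_pair_le hL2 hδ hδ1 hρ haK (zero_le_one.trans hav) hcK hcv hF p₂ x' M₂ V hM₂0 hV0
      (fun s' _ => le_rfl) (fun s' _ => hV s') (fun s' hs' => ⟨(hFfar s' hs').2.1, (hFfar s' hs').2.2⟩)
    calc ∑ y ∈ F, V y * K y ≤ ∑ y ∈ F, (M₁ y * V y + M₂ y * V y) :=
          Finset.sum_le_sum fun y _ => by nlinarith [mul_le_mul_of_nonneg_left (hKM y) (hV0 y), hM₁0 y, hM₂0 y]
      _ = ∑ y ∈ F, M₁ y * V y + ∑ y ∈ F, M₂ y * V y := Finset.sum_add_distrib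
      _ ≤ tf p₁ + tf p₂ := add_le_add h₁ h₂
  -- step 5: the leaving bonds, slice by slice
  have hexS : ∑ b ∈ exB Ω A, V b.src * K b.src ≤ (Fc.card : ℝ) * P.d * (tf p₁ + tf p₂) := by
    have hg : ∀ b ∈ exB Ω A, 0 ≤ V b.src * K b.src := fun b _ => mul_nonneg (hV0 _) (hK0 _)
    refine (sum_le_sum_cover (exB Ω A) Fc (fun f b => (b.src : HiggsLattice.Site P 0) f.1 = f.2) _ hg hexF).trans ?_
    have hpf : ∀ f ∈ Fc, ∑ b ∈ (exB Ω A).filter (fun b => (b.src : HiggsLattice.Site P 0) f.1 = f.2), V b.src * K b.src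
        ≤ (P.d : ℝ) * (tf p₁ + tf p₂) := by
      intro f _
      refine (sum_src_le _ (fun y => V y * K y) fun y => mul_nonneg (hV0 y) (hK0 y)).trans (mul_le_mul_of_nonneg_left ?_ hd0)
      refine hface _ f (fun s' hs' => ?_) (fun s' hs' => ?_)
      · obtain ⟨b, hb, rfl⟩ := Finset.mem_image.1 hs'
        exact (Finset.mem_filter.1 hb).2
      · obtain ⟨b, hb, rfl⟩ := Finset.mem_image.1 hs'
        exact hfar b (mem_exB.1 (Finset.mem_filter.1 hb).1).2.2
    calc ∑ f ∈ Fc, ∑ b ∈ (exB Ω A).filter (fun b => (b.src : HiggsLattice.Site P 0) f.1 = f.2), V b.src * K b.src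
        ≤ ∑ f ∈ Fc, (P.d : ℝ) * (tf p₁ + tf p₂) := Finset.sum_le_sum hpf
      _ = (Fc.card : ℝ) * P.d * (tf p₁ + tf p₂) := by rw [Finset.sum_const, nsmul_eq_mul]; ring
  -- step 6: the entering bonds, slice by slice
  have henS : ∑ b ∈ enB Ω A, V b.tgt * K b.tgt ≤ (Fc.card : ℝ) * P.d * (tf p₁ + tf p₂) := by
    have hg : ∀ b ∈ enB Ω A, 0 ≤ V b.tgt * K b.tgt := fun b _ => mul_nonneg (hV0 _) (hK0 _)
    refine (sum_le_sum_cover (enB Ω A) Fc (fun f b => (b.tgt : HiggsLattice.Site P 0) f.1 = f.2) _ hg henF).trans ?_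
    have hpf : ∀ f ∈ Fc, ∑ b ∈ (enB Ω A).filter (fun b => (b.tgt : HiggsLattice.Site P 0) f.1 = f.2), V b.tgt * K b.tgt
        ≤ (P.d : ℝ) * (tf p₁ + tf p₂) := by
      intro f _
      refine (sum_tgt_le _ (fun y => V y * K y) fun y => mul_nonneg (hV0 y) (hK0 y)).trans (mul_le_mul_of_nonneg_left ?_ hd0)
      refine hface _ f (fun s' hs' => ?_) (fun s' hs' => ?_)
      · obtain ⟨b, hb, rfl⟩ := Finset.mem_image.1 hs'
        exact (Finset.mem_filter.1 hb).2
      · obtain ⟨b, hb, rfl⟩ := Finset.mem_image.1 hs'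
        exact hfarT b (mem_enB.1 (Finset.mem_filter.1 hb).1).2.2
    calc ∑ f ∈ Fc, ∑ b ∈ (enB Ω A).filter (fun b => (b.tgt : HiggsLattice.Site P 0) f.1 = f.2), V b.tgt * K b.tgt
        ≤ ∑ f ∈ Fc, (P.d : ℝ) * (tf p₁ + tf p₂) := Finset.sum_le_sum hpf
      _ = (Fc.card : ℝ) * P.d * (tf p₁ + tf p₂) := by rw [Finset.sum_const, nsmul_eq_mul]; ring
  -- step 7: assemble
  have hfc0 : 0 ≤ (Fc.card : ℝ) * P.d * (tf p₁ + tf p₂) := by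
    have := htf0 p₁; have := htf0 p₂; positivity
  refine hsum.trans ?_
  have e1 := mul_le_mul_of_nonneg_left hexS hκex0
  have e2 := mul_le_mul_of_nonneg_left henS hκen0
  have e3 : κex * ((Fc.card : ℝ) * P.d * (tf p₁ + tf p₂)) + κen * ((Fc.card : ℝ) * P.d * (tf p₁ + tf p₂))
      = (Fc.card : ℝ) * P.d * (κex + κen) * (tf p₁ + tf p₂) := by ring
  rw [htf] at e3
  rw [← e3]
  linarith [e1, e2, hbulk]

end HolderRow

/-! ## §3 The two instances for the operator (1.16): `(n,n′) = (1,0)` and `(0,1)` -/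

section Instances

open scoped Classical

variable (C : ChargeData N) (Ω : Finset (HiggsLattice.Site P 0)) (A Y : HiggsLattice.VecField P 0) {msq : ℝ} (a : ℝ) {k : ℕ}
  (hmsq : 0 < msq) (hak : 0 ≤ B1.aSeq a P.L k)
  (hΩ : ∀ x x' : HiggsLattice.Site P 0, blockIter k x = blockIter k x' → (x ∈ Ω ↔ x' ∈ Ω))
include hmsq hak hΩ

/-- The Hölder functional `holT ∘ G_k(Ω,X)` kills every single-site field off `Ω` when both bonds lie in `Ω` (block-diagonality, §2 of
`B3Op116CollarSources`). [cite: Balaban1982Higgs1, (2.20) p.610] [cite: Balaban1983Higgs3, (2.11) p.426] -/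
theorem holT_propagatorK_single_eq_zero (X : HiggsLattice.VecField P 0) {x₁ x₂ : HiggsLattice.Site P 0} {μ : Fin P.d}
    (hx₁ : x₁ ∈ Ω) (hx₁' : x₁.shift μ ∈ Ω) (hx₂ : x₂ ∈ Ω) (hx₂' : x₂.shift μ ∈ Ω) (Γ : List (HiggsLattice.Site P 0))
    {y : HiggsLattice.Site P 0} (hy : y ∉ Ω) (v : E N) :
    (holT C Y x₁ x₂ Γ μ ∘ₗ (propagatorK C Ω X msq a k : ScalarField P 0 N →ₗ[ℝ] ScalarField P 0 N)) (Pi.single y v) = 0 := by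
  rw [LinearMap.coe_comp, Function.comp_apply, holT_apply]
  have h0 : ∀ {x : HiggsLattice.Site P 0}, x ∈ Ω → (propagatorK C Ω X msq a k) (Pi.single y v) x = 0 := fun hx =>
    propagatorK_single_apply_eq_zero_of_not_mem C Ω X a hmsq hak hΩ hy hx v
  rw [covDeriv_eq_zero_of_apply_eq_zero C Y _ (b := ⟨x₂, μ⟩) (h0 hx₂) (h0 hx₂'),
    covDeriv_eq_zero_of_apply_eq_zero C Y _ (b := ⟨x₁, μ⟩) (h0 hx₁) (h0 hx₁'), map_zero, sub_zero]

/-- **THE TWO-ANCHOR (HÖLDER-TRANSPORTED) ROW OF `(1.16)_{1,0}`** at far arguments: `T = holT_{x₁,x₂,Γ,μ} ∘ G_k(Ω,Y)`, states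
`G_k(Ω,P+Y)e_{(x′,i′)}` (`a_v = 2`), `Ω` a `k`-block union, the two bonds `⊂ Ω`, `x′ ∈ Ω`; the two-anchor column bound of `T`, the columns
of `G_k(Ω,P+Y)` and the geometry are hypotheses (the plug file).
[cite: Balaban1983Higgs3, (1.16) p.414, (2.11) p.426, p.433] [cite: Balaban1982Higgs1, (3.16) p.615, (3.44) p.619] -/
theorem holder_row_op116_one_zero_le (hL2 : 2 ≤ P.L) (hkK : k ≤ P.K) {δ ρ : ℝ} (hδ : 0 < δ) (hδ1 : δ ≤ 1) (hρ : 1 ≤ ρ)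
    {s δA cK cv cd aK : ℝ} (hs : 0 ≤ s) (hδA : 0 ≤ δA) (hcK : 0 ≤ cK) (hcv : 0 ≤ cv) (hcd : 0 ≤ cd) (haK : 0 ≤ aK)
    (hA : ∀ b : HiggsLattice.PBond P 0, |A b| ≤ s)
    (hregA : ∀ (z : HiggsLattice.Site P 0) (μ ν : Fin P.d), |A ⟨z.shift ν, μ⟩ - A ⟨z, μ⟩| ≤ δA) (i₀ : Ix N)
    {x₁ x₂ x' : HiggsLattice.Site P 0} {μ : Fin P.d} (hx₁ : x₁ ∈ Ω) (hx₁' : x₁.shift μ ∈ Ω) (hx₂ : x₂ ∈ Ω) (hx₂' : x₂.shift μ ∈ Ω)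
    (hx' : x' ∈ Ω) (Γ : List (HiggsLattice.Site P 0)) (p₁ p₂ : HiggsLattice.Site P 0)
    (hK : ∀ y, ∑ i : Ix N, ‖hol C Y x₁ Γ (covDeriv C Y (propagatorK C Ω Y msq a k (cb P N 0 (y, i))) ⟨x₂, μ⟩)
        - covDeriv C Y (propagatorK C Ω Y msq a k (cb P N 0 (y, i))) ⟨x₁, μ⟩‖ ≤ maj P k cK aK δ p₁ y + maj P k cK aK δ p₂ y)
    (hV : ∀ u, ∑ i' : Ix N, ‖propagatorK C Ω (A + Y) msq a k (cb P N 0 (x', i')) u‖ ≤ maj P k cv 2 δ u x')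
    (hD : ∀ b ∈ inB Ω A, ∑ i' : Ix N, ‖covDeriv C Y (propagatorK C Ω (A + Y) msq a k (cb P N 0 (x', i'))) b‖ ≤ maj P k cd 1 δ b.src x')
    (Fc : Finset (Σ ν : Fin P.d, ZMod (P.sitesPerDir 0 ν)))
    (hexF : ∀ b ∈ exB Ω A, ∃ f ∈ Fc, b.src f.1 = f.2) (henF : ∀ b ∈ enB Ω A, ∃ f ∈ Fc, b.tgt f.1 = f.2)
    (hfar : ∀ b : HiggsLattice.PBond P 0, (A b ≠ 0 ∨ A (pred b) ≠ 0) →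
      Far P k ρ p₁ b.src ∧ Far P k ρ p₂ b.src ∧ Far P k ρ b.src x')
    (hfarT : ∀ b : HiggsLattice.PBond P 0, A b ≠ 0 → Far P k ρ p₁ b.tgt ∧ Far P k ρ p₂ b.tgt ∧ Far P k ρ b.tgt x')
    (hfarZ : ∀ b : HiggsLattice.PBond P 0, A b ≠ 0 → ∀ z : HiggsLattice.Site P 0, blockIter k z = blockIter k b.src →
      Far P k ρ p₁ z ∧ Far P k ρ p₂ z) :
    ∑ i' : Ix N, ‖hol C Y x₁ Γ (covDeriv C Y (op116 C Ω A Y msq a k 1 0 (cb P N 0 (x', i'))) ⟨x₂, μ⟩)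
        - covDeriv C Y (op116 C Ω A Y msq a k 1 0 (cb P N 0 (x', i'))) ⟨x₁, μ⟩‖
      ≤ (top P k (farF P δ ρ * collarC P N k δ aK 0 2 cK 0 cv cd (|C.e| * s) ((P.mesh 0)⁻¹ * (|C.e| * δA)) ((|C.e| * s) ^ 2) 0 0
              (|B1.aSeq a P.L k| * (P.mesh k)⁻¹ ^ 2 *
                ((|C.e| * s * P.mesh 0 * (P.d * ((P.L : ℝ) ^ k - 1))) * (2 + |C.e| * s * P.mesh 0 * (P.d * ((P.L : ℝ) ^ k - 1))))))
            (aK + 2 - 1) (δ / 4) p₁ x'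
          + top P k (farF P δ ρ * collarC P N k δ aK 0 2 cK 0 cv cd (|C.e| * s) ((P.mesh 0)⁻¹ * (|C.e| * δA)) ((|C.e| * s) ^ 2) 0 0
              (|B1.aSeq a P.L k| * (P.mesh k)⁻¹ ^ 2 *
                ((|C.e| * s * P.mesh 0 * (P.d * ((P.L : ℝ) ^ k - 1))) * (2 + |C.e| * s * P.mesh 0 * (P.d * ((P.L : ℝ) ^ k - 1))))))
            (aK + 2 - 1) (δ / 4) p₂ x')
        + (Fc.card : ℝ) * P.d *
            (((P.mesh 0)⁻¹ * (|C.e| * δA) + (P.mesh 0)⁻¹ * (|C.e| * s)) + (3 * ((P.mesh 0)⁻¹ * (|C.e| * s)) + 2 * (|C.e| * s) ^ 2)) *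
          (top P k (farF P δ ρ * cK * (farC P δ * cv) * faceC P (δ / 2)) (aK + 2 - 1) (δ / 4) p₁ x'
            + top P k (farF P δ ρ * cK * (farC P δ * cv) * faceC P (δ / 2)) (aK + 2 - 1) (δ / 4) p₂ x') := by
  set T : ScalarField P 0 N →ₗ[ℝ] E N :=
    holT C Y x₁ x₂ Γ μ ∘ₗ (propagatorK C Ω Y msq a k : ScalarField P 0 N →ₗ[ℝ] ScalarField P 0 N) with hT
  have hTk : ∀ y : HiggsLattice.Site P 0, y ∉ Ω → ∀ v : E N, T (Pi.single y v) = 0 := fun y hy v =>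
    holT_propagatorK_single_eq_zero C Ω Y a hmsq hak hΩ Y hx₁ hx₁' hx₂ hx₂' Γ hy v
  have hw : ∀ (i' : Ix N) (y : HiggsLattice.Site P 0), y ∉ Ω → propagatorK C Ω (A + Y) msq a k (cb P N 0 (x', i')) y = 0 :=
    fun i' y hy => propagatorK_cb_apply_eq_zero_of_mem C Ω (A + Y) a hmsq hak hΩ hx' hy i'
  have hK' : ∀ y, ∑ i : Ix N, ‖T (cb P N 0 (y, i))‖ ≤ maj P k cK aK δ p₁ y + maj P k cK aK δ p₂ y := fun y => by
    simpa only [hT, LinearMap.coe_comp, Function.comp_apply, holT_apply] using hK y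
  have h := holder_row_collar_le C Ω A Y a hL2 hkK hδ hδ1 hρ (av := 2) hs hδA hcK hcv hcd haK (by norm_num) hA hregA i₀ T hTk p₁ p₂ x'
    (fun i' => propagatorK C Ω (A + Y) msq a k (cb P N 0 (x', i'))) hw hK' hV
    (fun b hb => by rw [show (2 : ℝ) - 1 = 1 by norm_num]; exact hD b hb) Fc hexF henF hfar hfarT hfarZ
  refine le_trans (le_of_eq (Finset.sum_congr rfl fun i' _ => ?_)) h
  rw [op116_succ_left_apply, op116_zero_zero_apply, hT, LinearMap.coe_comp, Function.comp_apply, holT_apply]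

/-- **THE TWO-ANCHOR (HÖLDER-TRANSPORTED) ROW OF `(1.16)_{0,1}`** at far arguments: `T = holT_{x₁,x₂,Γ,μ} ∘ G_k(Ω,P+Y)`, states
`G_k(Ω,Y)e_{(x′,i′)}`. [cite: Balaban1983Higgs3, (1.16) p.414, (2.11) p.426, p.433] [cite: Balaban1982Higgs1, (3.16) p.615, (3.44) p.619] -/
theorem holder_row_op116_zero_one_le (hL2 : 2 ≤ P.L) (hkK : k ≤ P.K) {δ ρ : ℝ} (hδ : 0 < δ) (hδ1 : δ ≤ 1) (hρ : 1 ≤ ρ)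
    {s δA cK cv cd aK : ℝ} (hs : 0 ≤ s) (hδA : 0 ≤ δA) (hcK : 0 ≤ cK) (hcv : 0 ≤ cv) (hcd : 0 ≤ cd) (haK : 0 ≤ aK)
    (hA : ∀ b : HiggsLattice.PBond P 0, |A b| ≤ s)
    (hregA : ∀ (z : HiggsLattice.Site P 0) (μ ν : Fin P.d), |A ⟨z.shift ν, μ⟩ - A ⟨z, μ⟩| ≤ δA) (i₀ : Ix N)
    {x₁ x₂ x' : HiggsLattice.Site P 0} {μ : Fin P.d} (hx₁ : x₁ ∈ Ω) (hx₁' : x₁.shift μ ∈ Ω) (hx₂ : x₂ ∈ Ω) (hx₂' : x₂.shift μ ∈ Ω)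
    (hx' : x' ∈ Ω) (Γ : List (HiggsLattice.Site P 0)) (p₁ p₂ : HiggsLattice.Site P 0)
    (hK : ∀ y, ∑ i : Ix N, ‖hol C Y x₁ Γ (covDeriv C Y (propagatorK C Ω (A + Y) msq a k (cb P N 0 (y, i))) ⟨x₂, μ⟩)
        - covDeriv C Y (propagatorK C Ω (A + Y) msq a k (cb P N 0 (y, i))) ⟨x₁, μ⟩‖ ≤ maj P k cK aK δ p₁ y + maj P k cK aK δ p₂ y)
    (hV : ∀ u, ∑ i' : Ix N, ‖propagatorK C Ω Y msq a k (cb P N 0 (x', i')) u‖ ≤ maj P k cv 2 δ u x')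
    (hD : ∀ b ∈ inB Ω A, ∑ i' : Ix N, ‖covDeriv C Y (propagatorK C Ω Y msq a k (cb P N 0 (x', i'))) b‖ ≤ maj P k cd 1 δ b.src x')
    (Fc : Finset (Σ ν : Fin P.d, ZMod (P.sitesPerDir 0 ν)))
    (hexF : ∀ b ∈ exB Ω A, ∃ f ∈ Fc, b.src f.1 = f.2) (henF : ∀ b ∈ enB Ω A, ∃ f ∈ Fc, b.tgt f.1 = f.2)
    (hfar : ∀ b : HiggsLattice.PBond P 0, (A b ≠ 0 ∨ A (pred b) ≠ 0) →
      Far P k ρ p₁ b.src ∧ Far P k ρ p₂ b.src ∧ Far P k ρ b.src x')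
    (hfarT : ∀ b : HiggsLattice.PBond P 0, A b ≠ 0 → Far P k ρ p₁ b.tgt ∧ Far P k ρ p₂ b.tgt ∧ Far P k ρ b.tgt x')
    (hfarZ : ∀ b : HiggsLattice.PBond P 0, A b ≠ 0 → ∀ z : HiggsLattice.Site P 0, blockIter k z = blockIter k b.src →
      Far P k ρ p₁ z ∧ Far P k ρ p₂ z) :
    ∑ i' : Ix N, ‖hol C Y x₁ Γ (covDeriv C Y (op116 C Ω A Y msq a k 0 1 (cb P N 0 (x', i'))) ⟨x₂, μ⟩)
        - covDeriv C Y (op116 C Ω A Y msq a k 0 1 (cb P N 0 (x', i'))) ⟨x₁, μ⟩‖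
      ≤ (top P k (farF P δ ρ * collarC P N k δ aK 0 2 cK 0 cv cd (|C.e| * s) ((P.mesh 0)⁻¹ * (|C.e| * δA)) ((|C.e| * s) ^ 2) 0 0
              (|B1.aSeq a P.L k| * (P.mesh k)⁻¹ ^ 2 *
                ((|C.e| * s * P.mesh 0 * (P.d * ((P.L : ℝ) ^ k - 1))) * (2 + |C.e| * s * P.mesh 0 * (P.d * ((P.L : ℝ) ^ k - 1))))))
            (aK + 2 - 1) (δ / 4) p₁ x'
          + top P k (farF P δ ρ * collarC P N k δ aK 0 2 cK 0 cv cd (|C.e| * s) ((P.mesh 0)⁻¹ * (|C.e| * δA)) ((|C.e| * s) ^ 2) 0 0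
              (|B1.aSeq a P.L k| * (P.mesh k)⁻¹ ^ 2 *
                ((|C.e| * s * P.mesh 0 * (P.d * ((P.L : ℝ) ^ k - 1))) * (2 + |C.e| * s * P.mesh 0 * (P.d * ((P.L : ℝ) ^ k - 1))))))
            (aK + 2 - 1) (δ / 4) p₂ x')
        + (Fc.card : ℝ) * P.d *
            (((P.mesh 0)⁻¹ * (|C.e| * δA) + (P.mesh 0)⁻¹ * (|C.e| * s)) + (3 * ((P.mesh 0)⁻¹ * (|C.e| * s)) + 2 * (|C.e| * s) ^ 2)) *
          (top P k (farF P δ ρ * cK * (farC P δ * cv) * faceC P (δ / 2)) (aK + 2 - 1) (δ / 4) p₁ x'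
            + top P k (farF P δ ρ * cK * (farC P δ * cv) * faceC P (δ / 2)) (aK + 2 - 1) (δ / 4) p₂ x') := by
  set T : ScalarField P 0 N →ₗ[ℝ] E N :=
    holT C Y x₁ x₂ Γ μ ∘ₗ (propagatorK C Ω (A + Y) msq a k : ScalarField P 0 N →ₗ[ℝ] ScalarField P 0 N) with hT
  have hTk : ∀ y : HiggsLattice.Site P 0, y ∉ Ω → ∀ v : E N, T (Pi.single y v) = 0 := fun y hy v =>
    holT_propagatorK_single_eq_zero C Ω Y a hmsq hak hΩ (A + Y) hx₁ hx₁' hx₂ hx₂' Γ hy v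
  have hw : ∀ (i' : Ix N) (y : HiggsLattice.Site P 0), y ∉ Ω → propagatorK C Ω Y msq a k (cb P N 0 (x', i')) y = 0 :=
    fun i' y hy => propagatorK_cb_apply_eq_zero_of_mem C Ω Y a hmsq hak hΩ hx' hy i'
  have hK' : ∀ y, ∑ i : Ix N, ‖T (cb P N 0 (y, i))‖ ≤ maj P k cK aK δ p₁ y + maj P k cK aK δ p₂ y := fun y => by
    simpa only [hT, LinearMap.coe_comp, Function.comp_apply, holT_apply] using hK y
  have h := holder_row_collar_le C Ω A Y a hL2 hkK hδ hδ1 hρ (av := 2) hs hδA hcK hcv hcd haK (by norm_num) hA hregA i₀ T hTk p₁ p₂ x'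
    (fun i' => propagatorK C Ω Y msq a k (cb P N 0 (x', i'))) hw hK' hV
    (fun b hb => by rw [show (2 : ℝ) - 1 = 1 by norm_num]; exact hD b hb) Fc hexF henF hfar hfarT hfarZ
  refine le_trans (le_of_eq (Finset.sum_congr rfl fun i' _ => ?_)) h
  rw [op116_succ_right_apply, op116_zero_zero_apply, hT, LinearMap.coe_comp, Function.comp_apply, holT_apply]

end Instances

end Literature.MathematicalPhysics.QuantumFieldTheory.Balaban1983to89.B3Op116CollarHolder

end
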